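import Literature.NumberTheory.GelbartRogawski1991.DoubledWeilRepresentationUniqueness
import Literature.NumberTheory.Automorphic.UnitaryRankThreeDiagonal
import Literature.LinearAlgebra.Matrix.UnitaryGroupHomDet
import Literature.LinearAlgebra.Matrix.GeneralLinearGroupHomDet
import Literature.NumberTheory.QuadraticForms.HermitianLocalIsotropy
import Literature.NumberTheory.Automorphic.UnitaryGroupAdelicDet
import HarnessLib

/-!
# Continuous characters of `U(J)(𝔸)` factor through the determinant (rank 3, diagonal hermitian `J`, CM case)

Topic `NumberTheory/Automorphic`; namespace `Literature.NumberTheory.Automorphic.UnitaryGroup.AdelicCharactersDet`.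
KERNEL only (theorems, no definition, no notation, no named fact, no `sorry`).

Setting: `L` a CM number field, `L⁺ = maximalRealSubfield L`, `c` = complex conjugation, `d : Fin 3 → L` with
`c dᵢ = dᵢ ≠ 0`, `J = diagonal d` (a non-degenerate hermitian form of rank 3), and the tree's adelic unitary group
`U(J)(𝔸_{L⁺}) = UnitaryGroup.adelic L⁺ L c 3 J ≤ GL₃(𝔸_L)` with its determinant
`UnitaryGroup.adelicDet : U(J)(𝔸) →* U(1)(𝔸)` (`UnitaryGroupAdelicDet`).

* **`apply_eq_one_of_det_eq_one`** — every CONTINUOUS homomorphism `χ : U(J)(𝔸_{L⁺}) →* ℂˣ` kills the elements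
  of determinant `1` (`SU(J)(𝔸) ≤ ker χ`);
* **`eq_comp_sec_comp_adelicDet`** — hence `χ = (χ ∘ sec) ∘ det` for ANY section `sec` of `adelicDet`
  (the input `hfac` of the pair-group adapter `UnitaryGroupPairCharactersDet`): this is the factorisation half of
  [GelbartRogawski1991, §3.1 Remark p. 457 L9–13] «`s* = s ⊗ ν′`, `ν′` an automorphic character of `E¹`, regarded
  as a character of `G` through `det`» for `G = U(3)`, proved here place by place: at a complex place the local group
  is `U(3)` or `U(2,1)` (`LinearAlgebra/Matrix/UnitaryGroupHomDet`, `UnitaryRankThreeDiagonal` with an explicit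
  isotropic vector), at a split finite place it is `GL₃(L_w)` (`LinearAlgebra/Matrix/GeneralLinearGroupHomDet`), at a
  non-split finite place it is the unitary group of `diag(d)` over the field `L ⊗ L⁺_v`, isotropic by
  `QuadraticForms/HermitianLocalIsotropy` (`UnitaryRankThreeDiagonal`); the adelic assembly is `g = g_∞ · g_f`,
  `U(J)(L⁺ ⊗ ℝ) ≅ ∏_w U(σ_w J)(ℂ)` (`archPiEquivCM`) and the density of the finitely supported elements of the
  determinant-one part of `U(J)(𝔸_f)` (`eqOn_of_eqOn_inter_finSupp`, `truncPlaces_insert`).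

## References

* S. Gelbart, J. Rogawski, Invent. Math. 105 (1991), §3.1 Remark p. 457 [GelbartRogawski1991].
* J. Dieudonné, *La géométrie des groupes classiques* (1971), Chap. II §5 [Dieudonne1971GroupesClassiques].
-/

set_option autoImplicit false

noncomputable section

open NumberField IsDedekindDomain Matrix
open scoped MatrixGroups

namespace Literature.NumberTheory.Automorphic

namespace UnitaryGroup.AdelicCharactersDet

open Literature.LinearAlgebra.Matrix Literature.NumberTheory.QuadraticForms NumberField.InfinitePlace
open Literature.NumberTheory.GelbartRogawski1991.UnitaryDualPair (imagUnit complexConj_imagUnit imagUnit_ne_zero)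

variable (L : Type) [Field L] [NumberField L] [IsCMField L] {A : Type*} [CommGroup A]
variable (d : Fin 3 → L) (hd : ∀ i, IsCMField.complexConj L (d i) = d i) (hd0 : ∀ i, d i ≠ 0)

/-! ## §0 Transport of `SU ≤ ker` along an equality of subgroups -/

/-- If `S = T` as subgroups and every hom on `T` kills the elements satisfying `P`, so does every hom on `S`. [folklore] -/
private theorem kills_of_eq {G : Type*} [Group G] {S T : Subgroup G} (e : S = T) (P : G → Prop)
    (hT : ∀ (θ' : ↥T →* A) (y : ↥T), P y.1 → θ' y = 1) (θ : ↥S →* A) (x : ↥S) (hx : P x.1) : θ x = 1 := by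
  subst e
  exact hT θ x hx

/-! ## §1 The complex places: `U(σ_w J)(ℂ)` is `U(3)` or `U(2,1)` -/

include hd hd0 in
/-- **At a complex place `w`, every homomorphism `U(σ_w J)(ℂ) →* A` kills the determinant-one elements**
(`σ_w J = diag(r)` real diagonal: definite ⇒ `UnitaryHomDet`, indefinite ⇒ `UnitaryRankThree` with the
isotropic vector `√(−r_j) e_i + √(r_i) e_j`). [cite: Dieudonne1971GroupesClassiques, Chap. II §5] -/
theorem archLocal_apply_eq_one (w : {w : InfinitePlace L // IsComplex w})
    (θ : ↥(UnitaryGroup.archLocal L 3 (Matrix.diagonal d) w) →* A)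
    (x : ↥(UnitaryGroup.archLocal L 3 (Matrix.diagonal d) w)) (hx : x.1.1.det = 1) : θ x = 1 := by
  classical
  have hc : IsCMField.complexConj L ≠ 1 := IsCMField.complexConj_ne_one L
  have hfix := UnitaryGroup.complexConj_smul_infinitePlace L
  -- `σ_w(dᵢ)` is real
  set r : Fin 3 → ℝ := fun i => (w.1.embedding (d i)).re with hr_def
  have hreal : ∀ i, w.1.embedding (d i) = ((r i : ℝ) : ℂ) := by
    intro i
    have h := UnitaryGroup.embedding_galConj (↥(maximalRealSubfield L)) L (IsCMField.complexConj L) w (hfix w.1) hc (d i)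
    rw [hd] at h
    exact (Complex.conj_eq_iff_re.1 h.symm).symm
  have hr0 : ∀ i, r i ≠ 0 := by
    intro i h0
    apply hd0 i
    have : w.1.embedding (d i) = 0 := by rw [hreal, h0]; simp
    exact (map_eq_zero _).1 this
  have hM : UnitaryGroup.archLocal L 3 (Matrix.diagonal d) w =
      unitaryGroupOfForm (starRingEnd ℂ) (Matrix.diagonal fun i => ((r i : ℝ) : ℂ)) := by
    show unitaryGroupOfForm (starRingEnd ℂ) ((Matrix.diagonal d).map w.1.embedding) = _
    rw [Matrix.diagonal_map (map_zero _)]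
    congr 2
    funext i
    exact hreal i
  refine kills_of_eq hM (fun y => (y : Matrix (Fin 3) (Fin 3) ℂ).det = 1) ?_ θ x hx
  intro θ' y hy
  by_cases hpos : ∀ i, 0 < r i
  · exact UnitaryHomDet.apply_eq_one_of_det_eq_one_diagonal_pos r hpos θ' y hy
  by_cases hneg : ∀ i, r i < 0
  · exact UnitaryHomDet.apply_eq_one_of_det_eq_one_diagonal_neg r hneg θ' y hy
  -- indefinite: an explicit isotropic vector
  simp only [not_forall, not_lt] at hpos hneg
  obtain ⟨j, hj⟩ := hpos
  obtain ⟨i, hi⟩ := hneg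
  have hj' : r j < 0 := lt_of_le_of_ne hj (hr0 j)
  have hi' : 0 < r i := lt_of_le_of_ne hi (Ne.symm (hr0 i))
  have hij : i ≠ j := fun h => by rw [h] at hi'; exact lt_irrefl _ (hi'.trans hj')
  refine UnitaryRankThree.apply_eq_one_of_det_eq_one_diagonal (σ := starRingEnd ℂ) (θ₀ := Complex.I)
    Complex.conj_conj Complex.conj_I Complex.I_ne_zero two_ne_zero (fun k => ((r k : ℝ) : ℂ))
    (fun k => Complex.conj_ofReal _) (fun k => by exact_mod_cast hr0 k) ?_ θ' y hy
  refine ⟨fun k => if k = i then ((Real.sqrt (-r j) : ℝ) : ℂ) else if k = j then ((Real.sqrt (r i) : ℝ) : ℂ) else 0,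
    ?_, ?_⟩
  · intro h0
    have := congrFun h0 i
    simp only [if_true, Pi.zero_apply, Complex.ofReal_eq_zero] at this
    exact (Real.sqrt_pos.2 (neg_pos.2 hj')).ne' this
  · have hsi : ((Real.sqrt (-r j) : ℝ) : ℂ) * (Real.sqrt (-r j) : ℝ) = ((-r j : ℝ) : ℂ) := by
      exact_mod_cast Real.mul_self_sqrt (neg_pos.2 hj').le
    have hsj : ((Real.sqrt (r i) : ℝ) : ℂ) * (Real.sqrt (r i) : ℝ) = ((r i : ℝ) : ℂ) := by
      exact_mod_cast Real.mul_self_sqrt hi'.le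
    rw [Finset.sum_eq_add_of_mem i j (Finset.mem_univ i) (Finset.mem_univ j) hij]
    · simp only [if_true, if_neg (Ne.symm hij), Complex.conj_ofReal]
      calc (Real.sqrt (-r j) : ℂ) * (r i : ℂ) * (Real.sqrt (-r j) : ℂ) +
            (Real.sqrt (r i) : ℂ) * (r j : ℂ) * (Real.sqrt (r i) : ℂ)
          = (r i : ℂ) * (((Real.sqrt (-r j) : ℝ) : ℂ) * (Real.sqrt (-r j) : ℝ)) +
            (r j : ℂ) * (((Real.sqrt (r i) : ℝ) : ℂ) * (Real.sqrt (r i) : ℝ)) := by ring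
        _ = 0 := by rw [hsi, hsj]; push_cast; ring
    · intro k _ hk
      simp only [if_neg hk.1, if_neg hk.2, map_zero, zero_mul]

/-! ## §2 The finite places -/

include hd hd0 in
/-- **At a finite place `v` of `L⁺`, every homomorphism `U(J)(L⁺_v) →* A` kills the elements all of whose
components have determinant one** (non-split `v`: `L ⊗ L⁺_v` is a field and `diag(d)` is isotropic there —
`HermitianLocal.exists_isotropic_localRing_cm` — so `UnitaryRankThree.apply_eq_one_of_det_eq_one_diagonal'`
applies; split `v`: `U(J)(L⁺_v) ≅ GL₃(L_w)` and `GLHomDet`). [cite: Dieudonne1971GroupesClassiques, Chap. II §5] -/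
theorem localPi_apply_eq_one (v : HeightOneSpectrum (𝓞 ↥(maximalRealSubfield L)))
    (θ : ↥(UnitaryGroup.localPi L (IsCMField.complexConj L) 3 (Matrix.diagonal d) v) →* A)
    (u : ↥(UnitaryGroup.localPi L (IsCMField.complexConj L) 3 (Matrix.diagonal d) v))
    (hu : ∀ w : UnitaryGroup.PlacesOver L v, (((u : UnitaryGroup.LocalGLPi L 3 v) w : GL (Fin 3) (w.1.adicCompletion L)) :
      Matrix (Fin 3) (Fin 3) (w.1.adicCompletion L)).det = 1) : θ u = 1 := by
  classical
  have hcδ : IsCMField.complexConj L (imagUnit L) = -imagUnit L := complexConj_imagUnit L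
  have hδ : imagUnit L ≠ 0 := imagUnit_ne_zero L
  have hc : IsCMField.complexConj L ≠ 1 := IsCMField.complexConj_ne_one L
  obtain ⟨w⟩ : Nonempty (UnitaryGroup.PlacesOver L v) := inferInstance
  by_cases hw : IsCMField.complexConj L • w.1 = w.1
  · -- non-split: the field `K = L ⊗ L⁺_v`
    letI : Field (UnitaryGroup.LocalRing L v) :=
      (UnitaryGroup.LocalRing.isField_of_smul_eq (IsCMField.complexConj L) hc w hw).toField
    have hσ : ∀ x, UnitaryGroup.conjLocal L (IsCMField.complexConj L) v
        (UnitaryGroup.conjLocal L (IsCMField.complexConj L) v x) = x :=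
      UnitaryGroup.conjLocal_conjLocal (IsCMField.complexConj L) v hcδ hδ
    have hθ : UnitaryGroup.conjLocal L (IsCMField.complexConj L) v
        (algebraMap L (UnitaryGroup.LocalRing L v) (imagUnit L)) = -algebraMap L (UnitaryGroup.LocalRing L v) (imagUnit L) := by
      rw [UnitaryGroup.conjLocal_algebraMap, hcδ, map_neg]
    have hθ0 : algebraMap L (UnitaryGroup.LocalRing L v) (imagUnit L) ≠ 0 := (_root_.map_ne_zero _).2 hδ
    have h2 : (2 : UnitaryGroup.LocalRing L v) ≠ 0 := by
      rw [← map_ofNat (algebraMap L (UnitaryGroup.LocalRing L v)) 2]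
      exact (_root_.map_ne_zero _).2 two_ne_zero
    set ψ := UnitaryGroup.localPiEquiv L (IsCMField.complexConj L) 3 (Matrix.diagonal d) v with hψ
    set p := ψ u with hp
    have hup : u = ψ.symm p := (ψ.symm_apply_apply u).symm
    -- the matrix of `p` has determinant one (componentwise)
    have hpdet : ((p : GL (Fin 3) (UnitaryGroup.LocalRing L v)) : Matrix (Fin 3) (Fin 3) (UnitaryGroup.LocalRing L v)).det = 1 := by
      funext w'
      have hmat : ((((ψ.symm p : UnitaryGroup.localPi L (IsCMField.complexConj L) 3 (Matrix.diagonal d) v) :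
          UnitaryGroup.LocalGLPi L 3 v) w' : GL (Fin 3) (w'.1.adicCompletion L)) :
            Matrix (Fin 3) (Fin 3) (w'.1.adicCompletion L)) =
          ((p : GL (Fin 3) (UnitaryGroup.LocalRing L v)) : Matrix (Fin 3) (Fin 3) (UnitaryGroup.LocalRing L v)).map
            (Pi.evalRingHom (fun w'' : UnitaryGroup.PlacesOver L v => w''.1.adicCompletion L) w') :=
        GLn.coe_piEquiv_apply _ _ _ _
      have h1 := hu w'
      rw [hup, hmat, ← RingHom.mapMatrix_apply, ← RingHom.map_det] at h1
      exact h1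
    -- the local form is `diag(d)` over `K`
    have hM : (UnitaryGroup.adelicForm L 3 (Matrix.diagonal d)).map (UnitaryGroup.adeleToLocal L v) =
        Matrix.diagonal (fun i => algebraMap L (UnitaryGroup.LocalRing L v) (d i)) := by
      rw [UnitaryGroup.adelicForm, Matrix.map_map, Matrix.diagonal_map]
      · rfl
      · exact map_zero _
    obtain ⟨x, hx0, hxx⟩ := HermitianLocal.exists_isotropic_localRing_cm L v (le_refl 3) hd
    have key := UnitaryRankThree.apply_eq_one_of_det_eq_one_diagonal'
      (σ := UnitaryGroup.conjLocal L (IsCMField.complexConj L) v) hσ hθ hθ0 h2 _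
      (fun i => algebraMap L (UnitaryGroup.LocalRing L v) (d i)) hM
      (fun i => by rw [UnitaryGroup.conjLocal_algebraMap, hd])
      (fun i => (_root_.map_ne_zero _).2 (hd0 i)) ⟨x, hx0, hxx⟩ (θ.comp ψ.symm.toMonoidHom) p hpdet
    rw [hup]
    exact key
  · -- split: `U(J)(L⁺_v) ≅ GL₃(L_w)`
    have hJh : ((Matrix.diagonal d).map (IsCMField.complexConj L : L →+* L))ᵀ = Matrix.diagonal d := by
      rw [Matrix.diagonal_map (map_zero _), Matrix.diagonal_transpose]
      congr 1; funext i; exact hd i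
    have hJu : IsUnit (Matrix.diagonal d) := by
      rw [Matrix.isUnit_iff_isUnit_det, Matrix.det_diagonal]
      exact isUnit_iff_ne_zero.2 (Finset.prod_ne_zero_iff.2 fun i _ => hd0 i)
    have hJw := UnitaryGroup.isUnit_placeForm (Matrix.diagonal d) hJu w.1
    set ψ := UnitaryGroup.localPiSplitEquiv (IsCMField.complexConj L) (Matrix.diagonal d) hc hJh w hw hJw with hψ
    have h2 : (2 : w.1.adicCompletion L) ≠ 0 := by
      rw [← map_ofNat (algebraMap L (w.1.adicCompletion L)) 2]
      exact (_root_.map_ne_zero _).2 two_ne_zero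
    have key : θ (ψ.symm (ψ u)) = 1 :=
      GLHomDet.apply_eq_one_of_val_det_eq_one_of_two_ne_zero h2 (θ.comp ψ.symm.toMonoidHom) (g := ψ u) (hu w)
    rwa [ψ.symm_apply_apply] at key

/-! ## §3 The finite-adelic assembly: density of the finitely supported determinant-one elements -/

include hd hd0 in
/-- **A continuous homomorphism `U(J)(𝔸_{L⁺,f}) →* ℂˣ` kills every element all of whose local components have
determinant one** (truncations are finite products of place inclusions, §2, and converge).
[cite: GelbartRogawski1991, §3.1 Remark p. 457] -/
theorem finAdelic_apply_eq_one
    (θ : ↥(UnitaryGroup.finAdelic (↥(maximalRealSubfield L)) L (IsCMField.complexConj L) 3 (Matrix.diagonal d)) →* ℂˣ)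
    (hθ : Continuous θ)
    (b : ↥(UnitaryGroup.finAdelic (↥(maximalRealSubfield L)) L (IsCMField.complexConj L) 3 (Matrix.diagonal d)))
    (hb : ∀ (v : HeightOneSpectrum (𝓞 ↥(maximalRealSubfield L))) (w : UnitaryGroup.PlacesOver L v),
      (((UnitaryGroup.evalPlace (↥(maximalRealSubfield L)) L (IsCMField.complexConj L) 3 (Matrix.diagonal d) v b :
        UnitaryGroup.localPi L (IsCMField.complexConj L) 3 (Matrix.diagonal d) v) : UnitaryGroup.LocalGLPi L 3 v) w :
          Matrix (Fin 3) (Fin 3) (w.1.adicCompletion L)).det = 1) : θ b = 1 := by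
  classical
  let P : Set ↥(UnitaryGroup.finAdelic (↥(maximalRealSubfield L)) L (IsCMField.complexConj L) 3 (Matrix.diagonal d)) :=
    {g | ∀ v (w : UnitaryGroup.PlacesOver L v),
      ((((UnitaryGroup.evalPlace (↥(maximalRealSubfield L)) L (IsCMField.complexConj L) 3 (Matrix.diagonal d) v g :
        UnitaryGroup.localPi L (IsCMField.complexConj L) 3 (Matrix.diagonal d) v) : UnitaryGroup.LocalGLPi L 3 v) w :
          GL (Fin 3) (w.1.adicCompletion L)) : Matrix (Fin 3) (Fin 3) (w.1.adicCompletion L)).det = 1}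
  have hP : ∀ g ∈ P, ∀ S, UnitaryGroup.truncPlaces (↥(maximalRealSubfield L)) L (IsCMField.complexConj L) 3
      (Matrix.diagonal d) S g ∈ P := by
    intro g hg S v w
    exact UnitaryGroup.truncPlaces_mem_setOf_forall (↥(maximalRealSubfield L)) L (IsCMField.complexConj L) 3 (Matrix.diagonal d)
      (p := fun v u => ∀ w : UnitaryGroup.PlacesOver L v,
        (((u : UnitaryGroup.LocalGLPi L 3 v) w : GL (Fin 3) (w.1.adicCompletion L)) :
          Matrix (Fin 3) (Fin 3) (w.1.adicCompletion L)).det = 1)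
      (fun v w => by simp) hg S v w
  -- on the finitely supported elements of `P`, by induction on the support
  have hind : ∀ g ∈ P, ∀ S : Finset (HeightOneSpectrum (𝓞 ↥(maximalRealSubfield L))),
      θ (UnitaryGroup.truncPlaces (↥(maximalRealSubfield L)) L (IsCMField.complexConj L) 3 (Matrix.diagonal d) S g) = 1 := by
    intro g hg S
    induction S using Finset.induction_on with
    | empty => rw [UnitaryGroup.truncPlaces_empty, map_one]
    | @insert v S hv ih =>
      rw [UnitaryGroup.truncPlaces_insert _ _ _ _ _ hv, map_mul, ih, mul_one]
      exact localPi_apply_eq_one L d hd hd0 v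
        (θ.comp (UnitaryGroup.inclPlace (↥(maximalRealSubfield L)) L (IsCMField.complexConj L) 3 (Matrix.diagonal d) v))
        _ (hg v)
  have hEq := UnitaryGroup.eqOn_of_eqOn_inter_finSupp (↥(maximalRealSubfield L)) L (IsCMField.complexConj L) 3
    (Matrix.diagonal d) hP (f := fun g => θ g) (f' := fun _ => (1 : ℂˣ)) hθ continuous_const ?_
  · exact hEq hb
  · rintro g ⟨hg, hgs⟩
    obtain ⟨S, hS⟩ := (UnitaryGroup.mem_finSupp_iff_exists_truncPlaces_eq (↥(maximalRealSubfield L)) L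
      (IsCMField.complexConj L) 3 (Matrix.diagonal d) g).1 hgs
    show θ g = 1
    rw [← hS]
    exact hind g hg S

/-! ## §4 The archimedean assembly -/

include hd hd0 in
/-- **A homomorphism `U(J)(L⁺ ⊗ ℝ) →* A` kills every element all of whose complex components have determinant one**
(`U(J)(L⁺ ⊗ ℝ) ≅ ∏_w U(σ_w J)(ℂ)`, §1, `Subgroup.pi_mem_of_mulSingle_mem`). [cite: GelbartRogawski1991, §3.1 Remark p. 457] -/
theorem arch_apply_eq_one
    (θ : ↥(UnitaryGroup.arch (↥(maximalRealSubfield L)) L (IsCMField.complexConj L) 3 (Matrix.diagonal d)) →* A)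
    (a : ↥(UnitaryGroup.arch (↥(maximalRealSubfield L)) L (IsCMField.complexConj L) 3 (Matrix.diagonal d)))
    (ha : ∀ w : {w : InfinitePlace L // IsComplex w},
      (((UnitaryGroup.archPiEquivCM 3 L (Matrix.diagonal d) a w : UnitaryGroup.archLocal L 3 (Matrix.diagonal d) w) :
        GL (Fin 3) ℂ) : Matrix (Fin 3) (Fin 3) ℂ).det = 1) : θ a = 1 := by
  classical
  set ψ := UnitaryGroup.archPiEquivCM 3 L (Matrix.diagonal d) with hψ
  set θ' : (∀ w : {w : InfinitePlace L // IsComplex w}, ↥(UnitaryGroup.archLocal L 3 (Matrix.diagonal d) w)) →* A :=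
    θ.comp ψ.symm.toMulEquiv.toMonoidHom with hθ'
  have hmem : ψ a ∈ θ'.ker := by
    refine Subgroup.pi_mem_of_mulSingle_mem (ψ a) fun w => ?_
    rw [MonoidHom.mem_ker]
    have := archLocal_apply_eq_one L d hd hd0 w
      (θ'.comp (MonoidHom.mulSingle (fun w' : {w : InfinitePlace L // IsComplex w} =>
        ↥(UnitaryGroup.archLocal L 3 (Matrix.diagonal d) w')) w)) (ψ a w) (ha w)
    simpa using this
  rw [MonoidHom.mem_ker] at hmem
  have hθa : θ' (ψ a) = θ a := by
    show θ (ψ.symm (ψ a)) = θ a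
    rw [ψ.symm_apply_apply]
  rw [← hθa, hmem]

/-! ## §5 The adelic assembly: `SU(J)(𝔸) ≤ ker χ` and the factorisation through `det` -/

include hd hd0 in
/-- **Every continuous homomorphism `χ : U(J)(𝔸_{L⁺}) →* ℂˣ` kills the elements of determinant one**
(`J = diag(d)` of rank 3 over the CM field `L`; `g = g_∞ · g_f`, §§3–4).
[cite: GelbartRogawski1991, §3.1 Remark p. 457] -/
theorem apply_eq_one_of_det_eq_one
    (χ : ↥(UnitaryGroup.adelic (↥(maximalRealSubfield L)) L (IsCMField.complexConj L) 3 (Matrix.diagonal d)) →* ℂˣ)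
    (hχ : Continuous χ)
    (g : ↥(UnitaryGroup.adelic (↥(maximalRealSubfield L)) L (IsCMField.complexConj L) 3 (Matrix.diagonal d)))
    (hg : ((g : GL (Fin 3) (AdeleRing (𝓞 L) L)) : Matrix (Fin 3) (Fin 3) (AdeleRing (𝓞 L) L)).det = 1) : χ g = 1 := by
  classical
  have hdec := UnitaryGroup.archToAdelic_mul_finAdelicToAdelic (↥(maximalRealSubfield L)) L (IsCMField.complexConj L) 3
    (Matrix.diagonal d) g
  -- archimedean components have determinant one
  have ha : ∀ w : {w : InfinitePlace L // IsComplex w},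
      (((UnitaryGroup.archPiEquivCM 3 L (Matrix.diagonal d)
        (UnitaryGroup.archPart (↥(maximalRealSubfield L)) L (IsCMField.complexConj L) 3 (Matrix.diagonal d) g) w :
          UnitaryGroup.archLocal L 3 (Matrix.diagonal d) w) : GL (Fin 3) ℂ) : Matrix (Fin 3) (Fin 3) ℂ).det = 1 := by
    intro w
    let Φ : AdeleRing (𝓞 L) L →+* ℂ :=
      (UnitaryGroup.evalC L w).comp ((InfiniteAdeleRing.ringEquiv_mixedSpace L).toRingHom.comp (RingHom.fst _ _))
    have hmat : (((UnitaryGroup.archPiEquivCM 3 L (Matrix.diagonal d)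
        (UnitaryGroup.archPart (↥(maximalRealSubfield L)) L (IsCMField.complexConj L) 3 (Matrix.diagonal d) g) w :
          UnitaryGroup.archLocal L 3 (Matrix.diagonal d) w) : GL (Fin 3) ℂ) : Matrix (Fin 3) (Fin 3) ℂ) =
        ((g : GL (Fin 3) (AdeleRing (𝓞 L) L)) : Matrix (Fin 3) (Fin 3) (AdeleRing (𝓞 L) L)).map Φ :=
      Matrix.ext fun i j => rfl
    rw [hmat, ← RingHom.mapMatrix_apply, ← RingHom.map_det, hg, map_one]
  -- finite components have determinant one
  have hb : ∀ (v : HeightOneSpectrum (𝓞 ↥(maximalRealSubfield L))) (w : UnitaryGroup.PlacesOver L v),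
      (((UnitaryGroup.evalPlace (↥(maximalRealSubfield L)) L (IsCMField.complexConj L) 3 (Matrix.diagonal d) v
        (UnitaryGroup.finPart (↥(maximalRealSubfield L)) L (IsCMField.complexConj L) 3 (Matrix.diagonal d) g) :
          UnitaryGroup.localPi L (IsCMField.complexConj L) 3 (Matrix.diagonal d) v) : UnitaryGroup.LocalGLPi L 3 v) w :
            Matrix (Fin 3) (Fin 3) (w.1.adicCompletion L)).det = 1 := by
    intro v w
    let Ψ : AdeleRing (𝓞 L) L →+* w.1.adicCompletion L :=
      (AdelicGroupData.finiteAdeleEval L w.1).comp (RingHom.snd _ _)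
    have hmat : ((((UnitaryGroup.evalPlace (↥(maximalRealSubfield L)) L (IsCMField.complexConj L) 3 (Matrix.diagonal d) v
        (UnitaryGroup.finPart (↥(maximalRealSubfield L)) L (IsCMField.complexConj L) 3 (Matrix.diagonal d) g) :
          UnitaryGroup.localPi L (IsCMField.complexConj L) 3 (Matrix.diagonal d) v) : UnitaryGroup.LocalGLPi L 3 v) w :
            GL (Fin 3) (w.1.adicCompletion L)) : Matrix (Fin 3) (Fin 3) (w.1.adicCompletion L)) =
        ((g : GL (Fin 3) (AdeleRing (𝓞 L) L)) : Matrix (Fin 3) (Fin 3) (AdeleRing (𝓞 L) L)).map Ψ :=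
      Matrix.ext fun i j => rfl
    rw [hmat, ← RingHom.mapMatrix_apply, ← RingHom.map_det, hg, map_one]
  have h1 := arch_apply_eq_one L d hd hd0
    (χ.comp (UnitaryGroup.archToAdelic (↥(maximalRealSubfield L)) L (IsCMField.complexConj L) 3 (Matrix.diagonal d)))
    _ ha
  have h2 := finAdelic_apply_eq_one L d hd hd0
    (χ.comp (UnitaryGroup.finAdelicToAdelic (↥(maximalRealSubfield L)) L (IsCMField.complexConj L) 3 (Matrix.diagonal d)))
    (hχ.comp (UnitaryGroup.continuous_finAdelicToAdelic (↥(maximalRealSubfield L)) L (IsCMField.complexConj L) 3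
      (Matrix.diagonal d))) _ hb
  rw [MonoidHom.comp_apply] at h1 h2
  exact (congrArg χ hdec.symm).trans ((map_mul χ _ _).trans ((congrArg₂ (· * ·) h1 h2).trans (one_mul 1)))

include hd hd0 in
/-- The determinant-one condition phrased with `UnitaryGroup.adelicDet`. [cite: GelbartRogawski1991, §3.1 Remark p. 457] -/
theorem apply_eq_one_of_adelicDet_eq_one (hJ : (Matrix.diagonal d).det ≠ 0)
    (χ : ↥(UnitaryGroup.adelic (↥(maximalRealSubfield L)) L (IsCMField.complexConj L) 3 (Matrix.diagonal d)) →* ℂˣ)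
    (hχ : Continuous χ)
    (g : ↥(UnitaryGroup.adelic (↥(maximalRealSubfield L)) L (IsCMField.complexConj L) 3 (Matrix.diagonal d)))
    (hg : UnitaryGroup.adelicDet (↥(maximalRealSubfield L)) L (IsCMField.complexConj L) 3 (Matrix.diagonal d) hJ g = 1) :
    χ g = 1 := by
  refine apply_eq_one_of_det_eq_one L d hd hd0 χ hχ g ?_
  have := congrArg (fun u : UnitaryGroup.adelicOne (↥(maximalRealSubfield L)) L (IsCMField.complexConj L) =>
    (((u : (AdeleRing (𝓞 L) L)ˣ) : AdeleRing (𝓞 L) L))) hg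
  simpa [UnitaryGroup.coe_coe_adelicDet] using this

include hd hd0 in
/-- **The factorisation through the determinant**: for ANY section `sec` of `adelicDet`, every continuous
`χ : U(J)(𝔸_{L⁺}) →* ℂˣ` equals `(χ ∘ sec) ∘ det` — [GelbartRogawski1991, §3.1 Remark p. 457 L9–13] for
`G = U(3)`: a character of `G(𝔸)` is a character of `E¹(𝔸)` composed with `det`.
[cite: GelbartRogawski1991, §3.1 Remark p. 457] -/
theorem eq_comp_sec_comp_adelicDet (hJ : (Matrix.diagonal d).det ≠ 0)
    (sec : ↥(UnitaryGroup.adelicOne (↥(maximalRealSubfield L)) L (IsCMField.complexConj L)) →*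
      ↥(UnitaryGroup.adelic (↥(maximalRealSubfield L)) L (IsCMField.complexConj L) 3 (Matrix.diagonal d)))
    (hsec : ∀ u, UnitaryGroup.adelicDet (↥(maximalRealSubfield L)) L (IsCMField.complexConj L) 3 (Matrix.diagonal d) hJ
      (sec u) = u)
    (χ : ↥(UnitaryGroup.adelic (↥(maximalRealSubfield L)) L (IsCMField.complexConj L) 3 (Matrix.diagonal d)) →* ℂˣ)
    (hχ : Continuous χ) :
    χ = (χ.comp sec).comp (UnitaryGroup.adelicDet (↥(maximalRealSubfield L)) L (IsCMField.complexConj L) 3 (Matrix.diagonal d) hJ) := by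
  refine MonoidHom.ext fun g => ?_
  set D := UnitaryGroup.adelicDet (↥(maximalRealSubfield L)) L (IsCMField.complexConj L) 3 (Matrix.diagonal d) hJ with hD
  have h1 : D (g * (sec (D g))⁻¹) = 1 := by rw [map_mul, map_inv, hsec, mul_inv_cancel]
  have h2 := apply_eq_one_of_adelicDet_eq_one L d hd hd0 hJ χ hχ _ h1
  rw [map_mul, map_inv, mul_inv_eq_one] at h2
  rw [MonoidHom.comp_apply, MonoidHom.comp_apply]
  exact h2

end UnitaryGroup.AdelicCharactersDet

end Literature.NumberTheory.Automorphic

end
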